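import Mathlib.Data.ZMod.Basic
import Mathlib.Data.Fintype.Sum
import Mathlib.Data.Finset.Powerset
import Mathlib.Tactic.FinCases

/-!
# The product `E × B₀` of the CM curve of `k` and a simple CM fivefold of a CYCLIC DECIC CM field `F ⊃ k` of
# half-circle type: every Galois-balanced weight is a disjoint union of conjugate pairs and the two `k`-Weil `6`-sets
# — a kernel census (12-point model)

COR-CM (cell `pub-hodgecm2`), seat b09 gen 18 (2026-08-21); count-neutral own lane DECIC-EB0 (lit-andre-3's prover-lane
ask A6-R22, PORTFOLIO-lit-andre-3-g10 §6; the seat that opened A6).  A finite, kernel-decided computation in the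
pattern of seat b30's `Census/DihedralSexticPairCurve.lean`: no named fact, no geometry, no `sorry`.

SETTING.  `F` a CM field, Galois over `ℚ` with CYCLIC group of order `10` (e.g. `ℚ(ζ₁₁)`, the decic subfield of
`ℚ(ζ_p)` for `p ≡ 11 (mod 20)`); `k ⊂ F` its imaginary quadratic subfield (fixed by `σ²`); a FRAME
`e : Hom(F, ℂ) ≃ ℤ/10` with `e(s ∘ σ) = e(s) + 1`, so that complex conjugation is `+5` and the restriction of `s` to `k`
is `τ` or `τ̄` according as `e(s)` is ODD or EVEN; the simple CM fivefold `B₀` realises the half-circle type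
`Φ₀ = {s | e(s) < 5}` (lit-andre-3's type `{0,1,2,3,4}`; its `Aut`-twist `{0,1,3,4,7}` = `B₂` is the same shape for the
generator `σ⁷`), and `E` the CM elliptic curve of `k` with `H^{1,0}(E)` the `τ`-line.  Then `k` acts on
`H^{1,0}(E × B₀)` with multiplicities `(1 + 2, 0 + 3) = (3, 3)`: the sixfold `E × B₀` is of WEIL TYPE for `k`.

MODEL.  Points `Pt = Bool ⊕ ZMod 10`: `inl b` = the embedding of `k` of sign `b` (slot `E`, `true` = `τ`), `inr j` = the
embedding `e⁻¹ j` of `F` (slot `B₀`); `g ∈ ℤ/10 = Gal(F/ℚ)` acts by `inr j ↦ inr (j + g)` and flips the sign of `inl b`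
iff `g` is odd (`act`); the CM type `phi` is `{inl true} ⊔ {inr j | j < 5}`.  GENERATING WEIGHTS (`gens`,
`12/2 + 2 = 8`): the conjugate pairs `{x, c·x}` (`c = act 5`; divisor classes) and the two `k`-WEIL `6`-SETS
`weil6 true = {inl true} ⊔ {inr j | j odd}` (the fibre of `τ`), `weil6 false = {inl false} ⊔ {inr j | j even}` (the
fibre of `τ̄`) — the `±i√d`-eigenlines `⋀⁶ H¹(E × B₀)_{±}` of the diagonal `k`-action, Hodge type `(3,3)`: the Weil plane
`W_k(E × B₀) ⊗ ℂ` of the sixfold (Markman's realm, arXiv:2502.03415 Thm 1.5.1 for the SPLIT polarisations).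

RESULTS (kernel): `isCMType_phi`, `gens_balanced`; **`balanced_classification`** — every balanced weight `S` of the
12-point model is conjugation-stable, or contains one of the two Weil `6`-sets with conjugation-stable complement;
`card_balanced` — `66 = 1+6+15+22+15+6+1` balanced weights (`22 = 20` pair-triples `+ 2` Weil sets in degree `6`), so
`dim B³(E × B₀) = 22 = dim D³ + 2`: the `{E, B₀}` sub-slice of the decic atlas has EXACTLY ONE atom (lit-andre-3
`Census/DecicCyclicWeilPlanes.subslice_E_B0`, here re-decided in the frame used by the transfer files).  The sequel
`Census/DecicCurveFivefoldPowers.lean` proves the same for ALL powers `E^c × B₀^a` by induction (no `decide`), and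
`CorCM/DecicCurveFivefoldPowersTransfer.lean` reads it on the real carriers.
DICTIONARY (formalised downstream, cited here) [cite: Pohlmann1968, Thm 1] [cite: GaoUllmo2025, Thm 3.1]
[cite: Deligne1982HodgeCycles, §5 (c)] [cite: MoonenZarhin1998WeilClasses, §1 (`n_σ`)].

## References
* [Pohlmann1968] H. Pohlmann, Ann. of Math. 88 (1968), Thm 1.  [GaoUllmo2025] Z. Gao, E. Ullmo, J. Inst. Math. Jussieu
  25 (2025), Thm 3.1.  [Deligne1982HodgeCycles] P. Deligne, LNM 900, §4–§5.  [MoonenZarhin1998WeilClasses] B. Moonen,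
  Yu. Zarhin, J. reine angew. Math. 496 (1998), §1.  [Markman2025SecantWeil] E. Markman, arXiv:2502.03415, Thm 1.5.1.

## Provenance
Exact python first (seat folder `scratch/decic_oracle.py`, < 1 s): 66 balanced weights, all classified; multiplicities
`(3,3)`; `scratch/decic_multiset.py`: the constant-defect law on all `3¹²` exponent vectors with entries `≤ 2`.
-/

namespace Summit.HodgeConjecture.CorCM.Census.DecicCurveFivefold

open Finset

/-! ### The model -/

/-- Points of `E × B₀`: `inl b` = the embedding of `k` of sign `b` (`true` = `τ`), `inr j` = the embedding `e⁻¹ j` of the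
decic field `F`. [cite: GaoUllmo2025, §2.1] -/
abbrev Pt : Type := Bool ⊕ ZMod 10

/-- The action of `g ∈ ℤ/10 = Gal(F/ℚ)`: translation on `Hom(F, ℂ)`, and on `Hom(k, ℂ)` the sign flips iff `g` is odd
(`σ|_k` generates `Gal(k/ℚ)`). [folklore] -/
def act (g : ZMod 10) : Pt → Pt
  | Sum.inl b => Sum.inl (if g.val % 2 = 0 then b else !b)
  | Sum.inr j => Sum.inr (j + g)

/-- Unfolding of `act` on the curve slot. [folklore] -/
theorem act_inl (g : ZMod 10) (b : Bool) : act g (Sum.inl b) = Sum.inl (if g.val % 2 = 0 then b else !b) := rfl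

/-- Unfolding of `act` on the fivefold slot. [folklore] -/
theorem act_inr (g : ZMod 10) (j : ZMod 10) : act g (Sum.inr j) = Sum.inr (j + g) := rfl

/-- The CM type read pointwise: `τ` on `E`, the half circle `{j < 5}` on `B₀`. [folklore] -/
def inPhi : Pt → Bool
  | Sum.inl b => b
  | Sum.inr j => decide (j.val < 5)

/-- The CM type of `E × B₀`: `{inl true} ⊔ {inr j | j < 5}`. [folklore] -/
def phi : Finset Pt := univ.filter fun x => inPhi x = true

/-- Membership in `phi`, curve slot. [folklore] -/
theorem mem_phi_inl (b : Bool) : Sum.inl b ∈ phi ↔ b = true := by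
  cases b <;> decide

/-- Membership in `phi`, fivefold slot. [folklore] -/
theorem mem_phi_inr (j : ZMod 10) : Sum.inr j ∈ phi ↔ j.val < 5 := by
  rw [phi, Finset.mem_filter, inPhi, decide_eq_true_eq]
  exact ⟨fun h => h.2, fun h => ⟨Finset.mem_univ _, h⟩⟩

/-- Pohlmann's condition for all ten `g ∈ ℤ/10`. [cite: GaoUllmo2025, Thm 3.1 eq. (3.2)] -/
def balanced (S : Finset Pt) : Bool :=
  decide (∀ g : ZMod 10, (S.filter fun x => act g x ∈ phi).card = (S.filter fun x => act g x ∉ phi).card)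

/-- Conjugation-stability (`c = act 5`). [folklore] -/
def conjStable (S : Finset Pt) : Bool := decide (∀ x ∈ S, act 5 x ∈ S)

/-! ### The generating weights -/

/-- The conjugate pair `{x, c·x}` (a divisor weight). [cite: Gordon1999HodgeAVSurvey, 9.2.2] -/
def conjPair (x : Pt) : Finset Pt := {x, act 5 x}

/-- The two `k`-Weil `6`-sets: `weil6 true` = the fibre of `τ` (`inl true` and the odd embeddings of `F`),
`weil6 false` = the fibre of `τ̄` (`inl false` and the even embeddings) — the `±i√d`-eigenlines `⋀⁶ H¹(E × B₀)_±`,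
Hodge type `(3,3)`. [cite: Deligne1982HodgeCycles, §5 (c)] [cite: MoonenZarhin1998WeilClasses, §1] -/
def weil6 : Bool → Finset Pt
  | true => {Sum.inl true, Sum.inr 1, Sum.inr 3, Sum.inr 5, Sum.inr 7, Sum.inr 9}
  | false => {Sum.inl false, Sum.inr 0, Sum.inr 2, Sum.inr 4, Sum.inr 6, Sum.inr 8}

/-- The eight generating weights. [folklore] -/
def gens : Finset (Finset Pt) := univ.image conjPair ∪ {weil6 true, weil6 false}

/-- Membership in `gens`, unfolded. [folklore] -/
theorem mem_gens_iff (g : Finset Pt) : g ∈ gens ↔ (∃ x, g = conjPair x) ∨ g = weil6 true ∨ g = weil6 false := by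
  rw [gens, Finset.mem_union, Finset.mem_image, Finset.mem_insert, Finset.mem_singleton]
  constructor
  · rintro (⟨x, -, rfl⟩ | h | h)
    · exact Or.inl ⟨x, rfl⟩
    · exact Or.inr (Or.inl h)
    · exact Or.inr (Or.inr h)
  · rintro (⟨x, rfl⟩ | h | h)
    · exact Or.inl ⟨x, Finset.mem_univ _, rfl⟩
    · exact Or.inr (Or.inl h)
    · exact Or.inr (Or.inr h)

/-- Membership in a conjugate pair. [folklore] -/
theorem mem_conjPair_iff (x y : Pt) : y ∈ conjPair x ↔ y = x ∨ y = act 5 x := by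
  rw [conjPair, Finset.mem_insert, Finset.mem_singleton]

/-- Membership in `weil6 b`, read by sign and parity: the point of `E` of sign `b` and the embeddings `j` of `F` with
`j` odd (`b = true`) resp. even (`b = false`). [cite: Deligne1982HodgeCycles, §5 (c)] -/
theorem mem_weil6_iff (b : Bool) (y : Pt) :
    y ∈ weil6 b ↔ y = Sum.inl b ∨ ∃ j : ZMod 10, y = Sum.inr j ∧ j.val % 2 = (if b then 1 else 0) := by
  revert y b
  decide

/-- Membership in `weil6 true`, enumerated. [folklore] -/
theorem mem_weil6_true_iff (y : Pt) : y ∈ weil6 true ↔ y = Sum.inl true ∨ y = Sum.inr 1 ∨ y = Sum.inr 3 ∨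
    y = Sum.inr 5 ∨ y = Sum.inr 7 ∨ y = Sum.inr 9 := by
  simp only [weil6, Finset.mem_insert, Finset.mem_singleton]

/-- Membership in `weil6 false`, enumerated. [folklore] -/
theorem mem_weil6_false_iff (y : Pt) : y ∈ weil6 false ↔ y = Sum.inl false ∨ y = Sum.inr 0 ∨ y = Sum.inr 2 ∨
    y = Sum.inr 4 ∨ y = Sum.inr 6 ∨ y = Sum.inr 8 := by
  simp only [weil6, Finset.mem_insert, Finset.mem_singleton]

/-- Every point lies in exactly one of the two Weil sets (they are the fibres of `τ`, `τ̄`). [folklore] -/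
theorem mem_weil6_true_or_false (y : Pt) : (y ∈ weil6 true ∨ y ∈ weil6 false) ∧ ¬ (y ∈ weil6 true ∧ y ∈ weil6 false) := by
  revert y
  decide

/-- Complex conjugation `c = act 5` on the curve slot flips the sign. [folklore] -/
theorem act_five_inl (b : Bool) : act 5 (Sum.inl b) = Sum.inl (!b) := by
  cases b <;> decide

/-- Complex conjugation `c = act 5` on the fibre of `τ̄`, tabulated. [folklore] -/
theorem act_five_weil6_false : act 5 (Sum.inl false) = Sum.inl true ∧ act 5 (Sum.inr 0) = Sum.inr 5 ∧
    act 5 (Sum.inr 2) = Sum.inr 7 ∧ act 5 (Sum.inr 4) = Sum.inr 9 ∧ act 5 (Sum.inr 6) = Sum.inr 1 ∧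
    act 5 (Sum.inr 8) = Sum.inr 3 := by
  decide

/-! ### Sanity of the model -/

set_option maxRecDepth 8000 in
/-- `phi` is a CM type (exactly one of `x`, `c·x`), and `c = act 5` is a fixed-point-free involution. [folklore] -/
theorem isCMType_phi : (∀ x : Pt, (x ∈ phi ↔ act 5 x ∉ phi)) ∧
    (∀ x : Pt, act 5 (act 5 x) = x) ∧ (∀ x : Pt, act 5 x ≠ x) := by
  refine ⟨by decide +kernel, by decide +kernel, by decide +kernel⟩

set_option maxRecDepth 8000 in
/-- **The sixfold `E × B₀` is of Weil type `(3,3)` for `k`**: the type `phi` meets each of the two Weil fibres in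
exactly `3` points. [cite: MoonenZarhin1998WeilClasses, §1 (`n_σ = n_σ̄`)] [cite: Deligne1982HodgeCycles, Prop. 4.4] -/
theorem weilType_three_three : (∀ b : Bool, ((weil6 b).filter fun x => x ∈ phi).card = 3) ∧
    (∀ b : Bool, (weil6 b).card = 6) ∧ Disjoint (weil6 true) (weil6 false) ∧ weil6 true ∪ weil6 false = univ := by
  refine ⟨by decide +kernel, by decide +kernel, by decide +kernel, by decide +kernel⟩

set_option maxRecDepth 32000 in
set_option maxHeartbeats 4000000 in
/-- The generating weights are balanced: the conjugate pairs, and the two Weil `6`-sets (six points, three in the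
type). [cite: Deligne1982HodgeCycles, §5 (c)] -/
theorem gens_balanced : (∀ x : Pt, balanced (conjPair x) = true ∧ (conjPair x).card = 2) ∧
    (∀ b : Bool, balanced (weil6 b) = true ∧ (weil6 b).card = 6 ∧ ((weil6 b).filter fun x => x ∈ phi).card = 3) := by
  refine ⟨by decide +kernel, by decide +kernel⟩

/-- The Weil sets are the two conjugation orbits' transversals: `c · weil6 b = weil6 (!b)` pointwise. [folklore] -/
theorem act_five_mem_weil6_iff (b : Bool) (y : Pt) : act 5 y ∈ weil6 (!b) ↔ y ∈ weil6 b := by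
  revert y b
  decide

/-! ### The census -/

set_option maxRecDepth 32000 in
set_option maxHeartbeats 8000000 in
/-- **Every Galois-balanced weight of `E × B₀` is conjugation-stable, or one of the two `k`-Weil `6`-sets together with a
conjugation-stable complement** — i.e. a disjoint union of conjugate pairs and at most one Weil set (the two Weil sets
together form the conjugation-stable `univ`). [cite: GaoUllmo2025, Thm 3.1] [cite: Deligne1982HodgeCycles, §5 (c)]
[cite: Markman2025SecantWeil, Thm 1.5.1] -/
theorem balanced_classification : ∀ S : Finset Pt, balanced S = true →
    conjStable S = true ∨ (weil6 true ⊆ S ∧ conjStable (S \ weil6 true) = true) ∨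
      (weil6 false ⊆ S ∧ conjStable (S \ weil6 false) = true) := by
  decide +kernel

set_option maxRecDepth 32000 in
set_option maxHeartbeats 8000000 in
/-- **The census**: `66 = 1+6+15+22+15+6+1` balanced weights (sizes `0, 2, …, 12`); in degree `6`,
`22 = 20` triples of conjugate pairs `+ 2` Weil sets: `dim B³(E × B₀) ⊗ ℂ = dim D³ ⊗ ℂ + 2`.
[cite: GaoUllmo2025, Thm 3.1] [cite: Pohlmann1968, Thm 1] -/
theorem card_balanced : ((univ : Finset (Finset Pt)).filter fun S => balanced S = true).card = 66 ∧
    (((univ : Finset Pt).powersetCard 4).filter fun S => balanced S = true).card = 15 ∧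
    (((univ : Finset Pt).powersetCard 6).filter fun S => balanced S = true).card = 22 ∧
    (((univ : Finset Pt).powersetCard 6).filter fun S => balanced S = true ∧ conjStable S = true).card = 20 := by
  refine ⟨by decide +kernel, by decide +kernel, by decide +kernel, by decide +kernel⟩

end Summit.HodgeConjecture.CorCM.Census.DecicCurveFivefold
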